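import Literature.MathematicalPhysics.QuantumFieldTheory.Balaban1983to89.T4ShellMeasureLocal

/-!
# T4ShellMeasureDet — node U5b/U5.E, cell input NE7c = `T4IndicatorShell.ShellWeightBound`, member (γ_loc) of the
shell-measure route ON THE REALIZED CONFIGURATION SPACE: the located reading (Det) TYPED over `GaugeField P j G` with
`fieldMeasure` (product Haar; both `Setup.lean`) as Mathlib's `DependsOn`; the block split `U ↦ (U|_Λ, U|_{Λᶜ})` as a
measure-preserving measurable equivalence, gluing = `Function.updateFinset` (the tree's fibre vocabulary); the chart
binder (CH) in the shape of the tree's `IsCubeImage`, carrying (M1) from the Euclidean block of `T4ShellMeasureLocal`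
to a block of group variables; and the realized twin of `slot_field_of_localDilation_placed`

(cell `pub-balaban`, T4-DAG v24 §6 row NE7c, fan-out seat `b2b-balaban-t4-ne7c-p1` gen 12, design row
T4-U5b.E2-NE7c-PROVE-P1o* = record `t4/T4-EST-NE7c-P1.md` v2.6 §5 (xix)(2) «the (Det) support statement typed over
`T4IndicatorShell`'s realized data (definition-level, for the U5.E owner to instantiate)»; imports
`T4ShellMeasureLocal` ONLY (hence `T4ShellMeasurePolar`, `T4ShellMeasureAnalytic`, `T4ShellMeasureFibre`,
`T4ShellMeasure`, `Setup`; consumed BY NAME: `slotAntiConcentration_of_sections`, `fibreAlternative_congr`,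
`fibreAlternative_polarDensity_mul`, `slot_field_of_massRatio`, `mass_le_two_mul_of_unionBound`,
`slotAntiConcentration_withDensity`, `polarDensity`, `dilate`, `fibreCoef_window_le`, `window_admissible`,
`slotAntiConcentration_comap`, `slotAntiConcentration_mono`, `SlotAntiConcentration`, `FibreAlternative`, `GaugeField`,
`fieldMeasure`, `HaarData`); companion record §3 (γ_loc) / §5, GAPS G-ne7cp1-19; PURE MEASURE THEORY, [folklore],
0 sorry: change of variables for push-forwards and densities, Mathlib's `measurePreserving_piEquivPiSubtypeProd`,
`DependsOn`, `Function.updateFinset`; every located input a binder.)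

HONEST FRAMING (T4-DAG PAGE 1).  Rung (B)+1 scoping of the T⁴-continuum cell: existence and uniqueness of the `ε → 0`
limit of unit-scale averaged expectations on a FIXED finite torus — NOT infinite volume, NOT a mass gap, NOT Clay, and
NOT a proof of NE7c.  Nothing of the run-A/run-B comparison is printed in [Balaban 1983–89]; nothing printed is
asserted here and no constant of Bałaban's is chosen.  Every conditional of the cell (BetaPertH, (B), (B^μ)) stays where
it is — upstream of the term families, untouched, to be displayed BY NAME by the consumer.  The READINGS named below
((Det), (CH), (FI), (DC-loc), (AN), (MR)) are located readings of the record, NOT printed as lemmas and NOT kernel: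
they enter as HYPOTHESES, never as facts.

WHY THIS LEAF.  `T4ShellMeasureLocal` (gen 11) states member (γ_loc) over an ABSTRACT product `E × Z` — `E` a
finite-dimensional real normed space with an additive Haar measure (the slot's block, in a chart), `Z` everything
else — and its dictionary binder (Det) («the tested variable depends on the configuration only through `E`») is the
product structure itself.  The U5.E owner who instantiates NE7c never meets `E × Z`: the cell's single-run laws live
on `GaugeField P j G = PBond P j → G` under `fieldMeasure P j G` = product Haar (`Setup.lean`), with measurable
functionals `u : GaugeField P j G → ℝ` and non-negative integrands `F : GaugeField P j G → ℝ≥0∞`, and the tree's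
U4-side modules already speak a FIBRE vocabulary on it — block space `↥Λ → G` for a finite set of bonds `Λ`, base law
`T4TiltModulus.fibreBase Λ = Measure.pi (fun _ => HaarData.haar)`, gluing `Function.updateFinset V Λ y`, chart
hypothesis `T4CubeChartTransport.IsCubeImage ν w n S φ jac : ν.withDensity w = (e^{−jac}·1_{[−S,S]ⁿ} dx).map φ`,
INHABITED for the production-type group `SU(2)` with the exponential chart by
`T4CubeChartExp.cubeChart_specialUnitaryTwo_exp` (other seats' leaves, pv16 / pv28 / pv26; cited BY NAME, NOT
imported: their import cone is the U4 side).  This leaf is the ADAPTER, definition-level, in that vocabulary: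
(i) (Det) becomes the Mathlib predicate `DependsOn u ↑Λ` — equivalently «the fibre sections `y ↦ u (updateFinset V Λ y)`
do not depend on the exterior `V`» (`dependsOn_iff_forall_updateFinset`) — a hypothesis the instantiator states about
ITS `u`, never a fact about Bałaban's; (ii) the block split `blockSplit Λ : GaugeField P j G ≃ᵐ (↥Λ → G) × (Λᶜ → G)`
is MEASURE-PRESERVING from product Haar to (block Haar) ⊗ (exterior Haar) (`measurePreserving_blockSplit`) and glues
as `updateFinset` (`blockSplit_symm_apply_eq_updateFinset`) — so `T4ShellMeasureLocal` §1 applies with `X = ↥Λ → G`,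
`Z = Λᶜ → G`, and (M1) for the realized law `(fieldMeasure P j G).withDensity F` follows from (M1) for the block law
tilted by EVERY fibre section `y ↦ F (updateFinset V Λ y)` (`slotAntiConcentration_realized_of_sections`); (iii) the
Euclidean block `E` of `T4ShellMeasureLocal` §2 enters through ONE displayed hypothesis per exterior, (CH):
`(blockLaw Λ).withDensity (w V) = (μE.withDensity (J V)).map (κ V)` — a window `w V` on the block, a chart map `κ V`,
a Jacobian weight `J V` (the orientation and shape of `IsCubeImage.map_eq`; exterior-dependent because print's
small-field charts are centred at exterior-determined backgrounds) — under which (M1) computed IN THE CHART (per-fibre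
alternatives along the contraction rays of `E`, `T4ShellMeasurePolar`) IS (M1) for the windowed block law: density
and push-forward commute (`withDensity_map_eq_map_withDensity_comp`) and (M1) pushes forward
(`slotAntiConcentration_map`).  Downstream of (M1) nothing changes: `slot_field_of_massRatio`,
`mass_le_two_mul_of_unionBound`, `T4ShellMeasure.slot_field_of_antiConcentration` are stated over any measurable space.

DICTIONARY (realized data ↦ the hypotheses of §4–§5; nothing here is asserted about Bałaban's objects).
`Ω = GaugeField P j G`, `μ_Ω = fieldMeasure P j G`; `Λ : Finset (PBond P j)` = the bonds read by the slot's tested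
variable `u_s` — (Det): B14 (2.16) `U_{k,□}(V_k) = U(𝐁_k(□^{∼4}), ·)` is determined by a set localized at the cube,
B15 p.177 (i), p.180 (1.19)–(1.20) the functions `U^{(n)}_{k,Z}` are «localized in the region Z», components in cubes of
size `100MR_k` — TYPED `DependsOn u ↑Λ`; block `↥Λ → G` with `blockLaw Λ` (the expression of `fibreBase Λ`), exterior
`{b // b ∉ Λ} → G` with `extLaw Λ` (both product Haar, probability); exteriors are parametrised by full configurations
`V` (as in `T4TiltModulus.fibreDensity`); `F : Ω → ℝ≥0∞` = the integrand of the dominating law — the instantiator's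
(2.18)-READING: the good term's weight with the slot's own indicator removed and the kept co-tests `χ` inside
(`T4ShellMeasureLocal` dictionary `f·χ`) — entering ONLY through the displayed mass hypotheses `hpiece` / `hfail` /
`hpass` of §5 and the fibre factorisation `F (updateFinset V Λ y) = w V y · R V y` (window × rest); (CH) per exterior
`V`: `E`, `μE`, `κ V`, `J V`, `w V` as in (iii) — for `SU(2)`: `E = (Fin n → ℝ)`, `n = 3·#Λ`, `κ V` = the exponential
fibre chart about a reference field, `J` = `1_{[−S,S]ⁿ}·e^{−expJac}`, `w V` = the product exponential window read at
`V` (`T4CubeChartExp`, BY NAME; the hypothesis SHAPE was checked against `IsCubeImage (fibreBase Λ) …` by this seat in a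
scratch file importing both modules: `exact hc.map_eq` after `rw [withDensity_indicator]` — recorded in the
companion record, not imported here); for general compact `G ⊂ U(N)`: NOT in the tree; in every case the passage from
print's gauge-invariant plaquette window (2.17) to a bond window in an axial gauge of the cube is the binder (LR) of
`T4ShellMeasureLocal` ([Balaban1985Averaging] (44)–(47) KIND) plus Haar-invariant gauge fixing (tree:
`T4AxialGaugeFixing.lintegral_eq_lintegral_fixBonds_of_treeOrder`, BY NAME, not imported) — the instantiator's, NOT
done here; the per-fibre alternatives `hfib V` along the rays `r ↦ updateFinset V Λ (κ V (e^{−r} ŷ))` = (AN) +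
(DC-loc) (the chart Jacobian inside `J V`) + (FI)/(KEPT-FI) of `T4ShellMeasureLocal`'s dictionary, unchanged binders;
the kept co-tests `χ` non-decreasing along every ray (`hmono`); (MR-m), (MR-q), (SM), (LR), (W1), (F∞): unchanged
(placed in kind / binders as recorded in `T4ShellMeasureLocal` §4, §8 and the record §3).

WHAT THIS LEAF DOES (kernel-checked, [folklore], 0 sorry).
* §1 transport of (M1): `slotAntiConcentration_map` / `_map_iff` ((M1) is invariant under push-forward by a measurable
  map, the tested variable composed — converse of `T4ShellMeasureFibre.slotAntiConcentration_comap`),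
  `withDensity_map_eq_map_withDensity_comp` (`(μ.map κ).withDensity G = (μ.withDensity (G ∘ κ)).map κ`),
  `slotAntiConcentration_withDensity_comap` / `_map` ((M1) for a tilted law through a `MeasurePreserving` map).
* §2 the chart binder: `withDensity_eq_map_chart` (under (CH), `μX.withDensity (w·R) = (ν.withDensity (J·(R∘κ))).map κ`),
  `slotAntiConcentration_of_chart` ((CH) + (M1) for `ν.withDensity (J·(R ∘ κ))` and `ū ∘ κ` ⇒ (M1) for
  `μX.withDensity (w·R)` and `ū`, same `θ ρ D`), `slotAntiConcentration_of_chart_restrict` (the chart law carried by a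
  measurable set `K`, literally the `IsCubeImage` shape; the (M1) hypothesis on the UNRESTRICTED `ν` tilted by
  `1_K·J·(R∘κ)`), `restrict_withDensity_eq_withDensity_indicator`.
* §3 the realized space: `blockSplit` (`MeasurableEquiv.piEquivPiSubtypeProd`; `.1 = Finset.restrict`, `rfl` simp
  lemmas), `blockSplit_symm_apply_eq_updateFinset` (gluing = `updateFinset`), `dependsOn_iff_forall_updateFinset`,
  `apply_updateFinset_of_dependsOn`, `dependsOn_iff_exists_comp_restrict` (`u = ū ∘ Λ.restrict`), `measurable_section`,
  `blockFn` (the fibre section at the trivial exterior) with `section_eq_blockFn_of_dependsOn`,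
  `eq_blockFn_restrict_of_dependsOn`, `measurable_blockFn`; `blockLaw`, `extLaw` (probability), `blockLaw_eq_pi`,
  `measurePreserving_blockSplit` (product Haar ↦ block ⊗ exterior), `fieldMeasure_preimage_prod` (independence of block
  and exterior for cylinder events).
* §4 `slotAntiConcentration_realized_of_sections` ((M1) for `(fieldMeasure P j G).withDensity F` from (M1) for the
  block law tilted by every fibre section, same constant), `slotAntiConcentration_realized_of_dependsOn` (under (Det)
  the variable of every section is `blockFn Λ u`).
* §5 `slotAntiConcentration_realized_local` ((CH) per exterior + the fibre factorisation of `F` + the per-fibre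
  alternative on every contraction ray of every chart ⇒ `SlotAntiConcentration ((fieldMeasure P j G).withDensity F) u θ
  ρ (2·fibreCoef δ B ℓ₀ L)`, NO multiplicity, NO presentation binder), `…_of_dependsOn`, and the END-TO-END REALIZED
  TWIN `slot_field_realized_placed` of `T4ShellMeasureLocal.slot_field_of_localDilation_placed`: law
  `(fieldMeasure P j G).withDensity (F·χ)`, admissible window `B·ℓ₀ ≤ (1−δ)/2`, (MR) by the union bound with `M = 2`,
  conclusion `Σ_{τ∈T} piece τ ≤ (8e²/(1−δ)·B·ρ)·Σ_{τ∈T} A τ` — the `slot` field of the level ledger for this slot, on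
  the realized space, LINEAR in the local rate `B`.
* §6 non-vacuity: (CH) fires (Lebesgue on `[0,1]` pushed to the one-point block is its windowed law); (Det) fires (a
  functional reading one bond `DependsOn` that bond; its fibre sections ignore the exterior; its block function is that
  reading); the gluing lemma on a concrete instance.

WHAT IT DOES NOT DO.  It constructs NO instance of (CH) (the `SU(2)` inhabitant lives in `T4CubeChartExp`, not
imported; for general `G` none exists in the tree), NO instance of (Det) for Bałaban's minimisers `U_{k,□}` (not
formalised anywhere), NO instance of the per-fibre alternatives, and NO gauge fixing; it mints no constant (`δ, s, B,
ℓ₀, ρ, θ, q, #I` stay binders exactly as in `T4ShellMeasureLocal`); it does not touch `T4IndicatorShell.ShellWeightBound`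
(the consumer reads the `slot` field into `T4ShellMeasureLevels.LevelLedger` / `T4ShellMeasure.SlotLedger.of_realized`
as before — those leaves are NOT imported here, by the lineage's import discipline); it is NOT a proof of NE7c.

PRINTED LOCI READ BY THIS SEAT (page images rendered by the cell, paths under the cell home; verbatim «»; the readings
drawn from them are BINDERS; the spans are quoted as loci of the KIND «tested variables are determined by a localized
set of bond variables», never as lemmas):
* [Balaban1988Convergent] (CMP 119) p.257 (renders `b2b-balaban-adv3/g9/b14-p257-top.png`,
  `b2b-balaban-pv06-g21/crops/b14p257_b.png`): «If we are given a determining set 𝐁, and the corresponding function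
  U_𝐁, then it is frequently necessary to localize them to a domain Ω.»; «We consider the partition of the lattice T_η
  into LM₂R_k-cubes, compatible with the other partitions, and for each cube □ of this partition we define the function
  U_{k,□}(V_k) by» (2.16) «U_{k,□}(V_k) = U(𝐁_k(□^{∼4}), M˙(Q_k^{s*}V_k))»; (2.17)
  «χ_k(Ω_k) = ∏_{□⊂Ω_k} χ({sup_{p⊂□^∼} |U_{k,□}(V_k, ∂p) − 1| < ε_k η²})».
* [Balaban1989LargeFieldI] (CMP 122) p.177 (render `b2b-balaban-adv4/b15-p177.png`): «More precisely, we take the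
  parts localized in neighborhoods of the domains Z′, so they do not depend on the large field regions Z″, and they are
  determined by small field effective actions only.»; «(i) it is contained in a cube of the size 100MR_k»; p.180
  (render `b2b-balaban-adv4/b15-p180.png`): «We need also a sequence of determining sets, and the corresponding sequence
  of functions, localized in the region Z.»; «The corresponding functions are defined by the gauge fields V restricted
  to Ω_k^c, and by M_{B_k(Z)}(Q_k^{s*}V_k) restricted to Z∩Ω_k, thus» (1.20).
WHAT IS READ, NOT PRINTED: that the slot's tested variable, AS A FUNCTION ON THE CONFIGURATION SPACE OF THE PENDING
FLUCTUATION INTEGRAL, factors through the bond variables of one cube (`DependsOn u ↑Λ`, `#Λ` of (2.5)-polylog size) —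
print localizes determining sets and minimisers, it states no lemma of this form; and (CH) — print works in exponential
/ axial coordinates on small-field regions ([Balaban1985Averaging] (44)–(47)), it states no push-forward identity.
Both are hypotheses here.

ABSOLUTE RULE.  No internally-minted statement enters as a cited fact: every hypothesis above is displayed BY NAME in
the theorem signatures; the manuscripts under audit are quoted only as loci, never for a disputed step; every
conditional of the cell (BetaPertH, (B), (B^μ)) is untouched and upstream.
-/

open MeasureTheory Set Function
open scoped NNReal ENNReal

namespace Literature.MathematicalPhysics.QuantumFieldTheory.Balaban1983to89.T4ShellMeasureDet

open T4ShellMeasure T4ShellMeasureFibre T4ShellMeasureAnalytic T4ShellMeasurePolar T4ShellMeasureLocal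

/-! ## §1  Transport of (M1): push-forward along a measurable map, change of variables under a density -/

section Transport

variable {Ω Ω' : Type*} [MeasurableSpace Ω] [MeasurableSpace Ω']

/-- **(M1) PUSHES FORWARD.**  If `μ` satisfies (M1) for `u' ∘ κ`, then the image law `μ.map κ` satisfies (M1) for
`u'` with the same constant (`κ`, `u'` measurable: the shell event of `u'` is measurable, so its image mass is the
mass of its preimage, the shell event of `u' ∘ κ`).  Converse of `T4ShellMeasureFibre.slotAntiConcentration_comap`.
[folklore] -/
theorem slotAntiConcentration_map {μ : Measure Ω} {κ : Ω → Ω'} (hκ : Measurable κ) {u' : Ω' → ℝ}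
    (hu' : Measurable u') {θ ρ D : ℝ} (h : SlotAntiConcentration μ (u' ∘ κ) θ ρ D) :
    SlotAntiConcentration (μ.map κ) u' θ ρ D := by
  have hS : MeasurableSet {x : Ω' | θ * (1 - ρ) ≤ u' x ∧ u' x < θ} :=
    (measurableSet_le measurable_const hu').inter (measurableSet_lt hu' measurable_const)
  unfold SlotAntiConcentration at *
  rw [Measure.map_apply hκ hS, Measure.map_apply hκ MeasurableSet.univ, preimage_univ]
  exact h

/-- (M1) for an image law and (M1) for the source law with the composed variable are EQUIVALENT (`κ`, `u'`
measurable). [folklore] -/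
theorem slotAntiConcentration_map_iff {μ : Measure Ω} {κ : Ω → Ω'} (hκ : Measurable κ) {u' : Ω' → ℝ}
    (hu' : Measurable u') {θ ρ D : ℝ} :
    SlotAntiConcentration (μ.map κ) u' θ ρ D ↔ SlotAntiConcentration μ (u' ∘ κ) θ ρ D :=
  ⟨slotAntiConcentration_comap hκ, slotAntiConcentration_map hκ hu'⟩

/-- **CHANGE OF VARIABLES UNDER A DENSITY.**  Tilting an image law by a density is the image of the source law
tilted by the pulled-back density: `(μ.map κ).withDensity G = (μ.withDensity (G ∘ κ)).map κ` (`κ`, `G` measurable).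
[folklore] -/
theorem withDensity_map_eq_map_withDensity_comp {μ : Measure Ω} {κ : Ω → Ω'} (hκ : Measurable κ)
    {G : Ω' → ℝ≥0∞} (hG : Measurable G) : (μ.map κ).withDensity G = (μ.withDensity (G ∘ κ)).map κ := by
  ext s hs
  rw [withDensity_apply _ hs, setLIntegral_map hs hG hκ, Measure.map_apply hκ hs, withDensity_apply _ (hκ hs)]
  rfl

/-- **(M1) THROUGH A MEASURE-PRESERVING CHANGE OF VARIABLES, WITH A DENSITY** (pull-back direction): if
`e : Ω → Ω'` pushes `μ` to `μ'` and the tilted law `μ'.withDensity G` satisfies (M1) for `u'`, then the tilted source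
law `μ.withDensity (G ∘ e)` satisfies (M1) for `u' ∘ e`, same constant. [folklore] -/
theorem slotAntiConcentration_withDensity_comap {μ : Measure Ω} {μ' : Measure Ω'} {e : Ω → Ω'}
    (he : MeasurePreserving e μ μ') {G : Ω' → ℝ≥0∞} (hG : Measurable G) {u' : Ω' → ℝ} {θ ρ D : ℝ}
    (h : SlotAntiConcentration (μ'.withDensity G) u' θ ρ D) :
    SlotAntiConcentration (μ.withDensity (G ∘ e)) (u' ∘ e) θ ρ D := by
  rw [← he.map_eq, withDensity_map_eq_map_withDensity_comp he.measurable hG] at h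
  exact slotAntiConcentration_comap he.measurable h

/-- **(M1) THROUGH A MEASURE-PRESERVING CHANGE OF VARIABLES, WITH A DENSITY** (push-forward direction, `u'`
measurable). [folklore] -/
theorem slotAntiConcentration_withDensity_map {μ : Measure Ω} {μ' : Measure Ω'} {e : Ω → Ω'}
    (he : MeasurePreserving e μ μ') {G : Ω' → ℝ≥0∞} (hG : Measurable G) {u' : Ω' → ℝ} (hu' : Measurable u')
    {θ ρ D : ℝ} (h : SlotAntiConcentration (μ.withDensity (G ∘ e)) (u' ∘ e) θ ρ D) :
    SlotAntiConcentration (μ'.withDensity G) u' θ ρ D := by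
  rw [← he.map_eq, withDensity_map_eq_map_withDensity_comp he.measurable hG]
  exact slotAntiConcentration_map he.measurable hu' h

end Transport

/-! ## §2  The chart binder (CH): (M1) computed in a Euclidean chart of a block of group variables -/

section Chart

variable {X : Type*} [MeasurableSpace X] {Y : Type*} [MeasurableSpace Y]

/-- Under (CH) the windowed, tilted block law IS the image of the tilted chart law:
`μX.withDensity (w·R) = (ν.withDensity (J·(R ∘ κ))).map κ`. [folklore] -/
theorem withDensity_eq_map_chart (μX : Measure X) (ν : Measure Y) {κ : Y → X} (hκ : Measurable κ)
    {J : Y → ℝ≥0∞} (hJ : Measurable J) {w : X → ℝ≥0∞} (hw : Measurable w)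
    (hchart : μX.withDensity w = (ν.withDensity J).map κ) {R : X → ℝ≥0∞} (hR : Measurable R) :
    μX.withDensity (fun x => w x * R x) = (ν.withDensity fun y => J y * R (κ y)).map κ := by
  have h1 : μX.withDensity (fun x => w x * R x) = (μX.withDensity w).withDensity R := withDensity_mul _ hw hR
  have h2 : (ν.withDensity J).withDensity (R ∘ κ) = ν.withDensity fun y => J y * R (κ y) := by
    rw [← withDensity_mul _ hJ (hR.comp hκ)]
    rfl
  rw [h1, hchart, withDensity_map_eq_map_withDensity_comp hκ hR, h2]

/-- **THE CHART BINDER (CH) ⇒ (M1) ON THE BLOCK FROM (M1) IN THE CHART.**  Data: a block law `μX` on a block space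
`X`; a WINDOW weight `w` on `X` (the local small-field indicator of the block, or any measurable weight); a chart
`κ : Y → X` from a chart space `Y` carrying a reference law `ν` and a Jacobian weight `J`, with the CHART IDENTITY (CH)
`μX.withDensity w = (ν.withDensity J).map κ` — the windowed block law is the image of the tilted chart law (the
orientation and shape of the tree's chart hypothesis `T4CubeChartTransport.IsCubeImage.map_eq`, a module NOT
imported here); a further measurable block weight `R`; a measurable block variable `ū`.  If the chart law tilted by
`J·(R ∘ κ)` satisfies (M1) for the variable read in the chart `ū ∘ κ`, then the block law tilted by `w·R` satisfies
(M1) for `ū`, same constants.  ((CH) is a HYPOTHESIS SHAPE; no chart is constructed in this module: the gauge group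
of `Setup` is an abstract compact measurable group.) [folklore] -/
theorem slotAntiConcentration_of_chart (μX : Measure X) (ν : Measure Y) {κ : Y → X} (hκ : Measurable κ)
    {J : Y → ℝ≥0∞} (hJ : Measurable J) {w : X → ℝ≥0∞} (hw : Measurable w)
    (hchart : μX.withDensity w = (ν.withDensity J).map κ) {R : X → ℝ≥0∞} (hR : Measurable R)
    {ū : X → ℝ} (hū : Measurable ū) {θ ρ D : ℝ}
    (h : SlotAntiConcentration (ν.withDensity fun y => J y * R (κ y)) (ū ∘ κ) θ ρ D) :
    SlotAntiConcentration (μX.withDensity fun x => w x * R x) ū θ ρ D := by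
  rw [withDensity_eq_map_chart μX ν hκ hJ hw hchart hR]
  exact slotAntiConcentration_map hκ hū h

/-- (CH) with the chart law carried by a measurable set `K` of the chart space — the literal shape of
`IsCubeImage.map_eq`, whose chart law is `(volume.restrict (cube n S)).withDensity (e^{−jac})`: the same conclusion,
the (M1) hypothesis being about the UNRESTRICTED reference law `ν` tilted by `1_K·J·(R ∘ κ)` (so that `ν` may be an
additive Haar measure, as §5 needs). [folklore] -/
theorem slotAntiConcentration_of_chart_restrict (μX : Measure X) (ν : Measure Y) {K : Set Y}
    (hK : MeasurableSet K) {κ : Y → X} (hκ : Measurable κ) {J : Y → ℝ≥0∞} (hJ : Measurable J) {w : X → ℝ≥0∞}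
    (hw : Measurable w) (hchart : μX.withDensity w = ((ν.restrict K).withDensity J).map κ) {R : X → ℝ≥0∞}
    (hR : Measurable R) {ū : X → ℝ} (hū : Measurable ū) {θ ρ D : ℝ}
    (h : SlotAntiConcentration (ν.withDensity fun y => K.indicator J y * R (κ y)) (ū ∘ κ) θ ρ D) :
    SlotAntiConcentration (μX.withDensity fun x => w x * R x) ū θ ρ D :=
  slotAntiConcentration_of_chart μX ν hκ (hJ.indicator hK) hw (by rwa [withDensity_indicator hK]) hR hū h

/-- the restricted chart law as an unrestricted one with the indicator inside the Jacobian weight. [folklore] -/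
theorem restrict_withDensity_eq_withDensity_indicator (ν : Measure Y) {K : Set Y} (hK : MeasurableSet K)
    (J : Y → ℝ≥0∞) : (ν.restrict K).withDensity J = ν.withDensity (K.indicator J) :=
  (withDensity_indicator hK J).symm

end Chart

/-! ## §3  The realized configuration space: `GaugeField` (`Setup.lean`), product Haar, the block split, (Det) -/

section Realized

variable {P : Params} {j : ℕ} {G : Type*} [MeasurableSpace G] [DecidableEq (PBond P j)]

/-- The BLOCK SPLIT of a gauge-field configuration along a finite set of bonds `Λ` (the bonds of the slot's
localization cube): `U ↦ (U|_Λ, U|_{Λᶜ})`, a measurable equivalence `GaugeField P j G ≃ᵐ (Λ → G) × (Λᶜ → G)`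
(Mathlib's `MeasurableEquiv.piEquivPiSubtypeProd`).  The block space `↥Λ → G` is the FIBRE space of the tree's
U4-side modules (`T4TiltModulus.fibreBase Λ`, `T4CubeChartTransport.CubeChart Λ …`, NOT imported here), and gluing
is Mathlib's `Function.updateFinset` (`blockSplit_symm_apply_eq_updateFinset`). [folklore] -/
def blockSplit (Λ : Finset (PBond P j)) : GaugeField P j G ≃ᵐ (↥Λ → G) × ({b // b ∉ Λ} → G) :=
  MeasurableEquiv.piEquivPiSubtypeProd (fun _ : PBond P j => G) (· ∈ Λ)

variable (Λ : Finset (PBond P j))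

/-- the block split reads off the block variables: its first component is `Finset.restrict`. [folklore] -/
@[simp] theorem blockSplit_apply_fst (U : GaugeField P j G) : (blockSplit (G := G) Λ U).1 = Λ.restrict U := rfl

/-- the block split reads off the exterior variables. [folklore] -/
@[simp] theorem blockSplit_apply_snd (U : GaugeField P j G) (b : {b // b ∉ Λ}) :
    (blockSplit (G := G) Λ U).2 b = U b := rfl

/-- gluing a block configuration and an exterior configuration. [folklore] -/
theorem blockSplit_symm_apply (y : ↥Λ → G) (z : {b // b ∉ Λ} → G) (b : PBond P j) :
    (blockSplit (G := G) Λ).symm (y, z) b = if h : b ∈ Λ then y ⟨b, h⟩ else z ⟨b, h⟩ := rfl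

/-- gluing, on a block bond. [folklore] -/
@[simp] theorem blockSplit_symm_apply_of_mem (y : ↥Λ → G) (z : {b // b ∉ Λ} → G) {b : PBond P j}
    (hb : b ∈ Λ) : (blockSplit (G := G) Λ).symm (y, z) b = y ⟨b, hb⟩ := by
  rw [blockSplit_symm_apply, dif_pos hb]

/-- gluing, on an exterior bond. [folklore] -/
@[simp] theorem blockSplit_symm_apply_of_not_mem (y : ↥Λ → G) (z : {b // b ∉ Λ} → G) {b : PBond P j}
    (hb : b ∉ Λ) : (blockSplit (G := G) Λ).symm (y, z) b = z ⟨b, hb⟩ := by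
  rw [blockSplit_symm_apply, dif_neg hb]

/-- **GLUING IS `Function.updateFinset`.**  The block configuration `y` glued with the exterior part of a
configuration `V` is `updateFinset V Λ y` — the tree's fibre parametrisation (`fibreDensity Λ old V = fun y =>
old (updateFinset V Λ y)` in `T4TiltModulus`). [folklore] -/
theorem blockSplit_symm_apply_eq_updateFinset (y : ↥Λ → G) (V : GaugeField P j G) :
    (blockSplit (G := G) Λ).symm (y, (blockSplit (G := G) Λ V).2) = updateFinset V Λ y := by
  funext b
  by_cases hb : b ∈ Λ
  · rw [blockSplit_symm_apply_of_mem Λ y _ hb]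
    simp [updateFinset, hb]
  · rw [blockSplit_symm_apply_of_not_mem Λ y _ hb, blockSplit_apply_snd]
    simp [updateFinset, hb]

/-- … and two gluings with the same exterior differ by an `updateFinset` on the block. [folklore] -/
theorem blockSplit_symm_apply_eq_updateFinset' (y y₀ : ↥Λ → G) (z : {b // b ∉ Λ} → G) :
    (blockSplit (G := G) Λ).symm (y, z) = updateFinset ((blockSplit (G := G) Λ).symm (y₀, z)) Λ y := by
  funext b
  by_cases hb : b ∈ Λ
  · rw [blockSplit_symm_apply_of_mem Λ y z hb]
    simp [updateFinset, hb]
  · rw [blockSplit_symm_apply_of_not_mem Λ y z hb]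
    simp [updateFinset, hb]

omit [MeasurableSpace G] in
/-- **(Det), TYPED.**  The located reading (Det) — «the tested variable of the slot depends on the configuration of
the pending fluctuation integral only through the block of variables attached to its localization cube» (B14 (2.16):
`U_{k,□}(V_k)` is determined by the set `𝐁_k(□^{∼4})`; B15 p.177 (i), p.180 (1.19)–(1.20): the functions
`U^{(n)}_{k,Z}` are localized in `Z`) — is Mathlib's `DependsOn u ↑Λ`; in the tree's fibre vocabulary it says exactly:
THE FIBRE SECTIONS OF `u` DO NOT DEPEND ON THE EXTERIOR. [folklore] -/
theorem dependsOn_iff_forall_updateFinset {β : Type*} {u : GaugeField P j G → β} :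
    DependsOn u (Λ : Set (PBond P j)) ↔
      ∀ (V V' : GaugeField P j G) (y : ↥Λ → G), u (updateFinset V Λ y) = u (updateFinset V' Λ y) := by
  constructor
  · intro h V V' y
    exact h fun b hb => by simp [updateFinset, Finset.mem_coe.mp hb]
  · intro h U U' hUU'
    have hr : Λ.restrict U = Λ.restrict U' := funext fun b => hUU' b (Finset.mem_coe.mpr b.2)
    calc u U = u (updateFinset U Λ (Λ.restrict U)) := by rw [Function.updateFinset_restrict]
      _ = u (updateFinset U' Λ (Λ.restrict U)) := h U U' _
      _ = u U' := by rw [hr, Function.updateFinset_restrict]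

omit [MeasurableSpace G] in
/-- under (Det) the fibre sections of `u` do not depend on the exterior. [folklore] -/
theorem apply_updateFinset_of_dependsOn {β : Type*} {u : GaugeField P j G → β} (h : DependsOn u (Λ : Set (PBond P j)))
    (V V' : GaugeField P j G) (y : ↥Λ → G) : u (updateFinset V Λ y) = u (updateFinset V' Λ y) :=
  (dependsOn_iff_forall_updateFinset Λ).1 h V V' y

omit [MeasurableSpace G] [DecidableEq (PBond P j)] in
/-- under (Det), `u` factors through the block variables: `u = ū ∘ Λ.restrict`. [folklore] -/
theorem dependsOn_iff_exists_comp_restrict {β : Type*} [Nonempty β] {u : GaugeField P j G → β} :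
    DependsOn u (Λ : Set (PBond P j)) ↔ ∃ ū : (↥Λ → G) → β, u = ū ∘ Λ.restrict := by
  rw [dependsOn_iff_exists_comp]
  rfl

/-- fibre sections of a measurable functional are measurable. [folklore] -/
theorem measurable_section {β : Type*} [MeasurableSpace β] {u : GaugeField P j G → β} (hu : Measurable u)
    (V : GaugeField P j G) : Measurable fun y : ↥Λ → G => u (updateFinset V Λ y) :=
  hu.comp measurable_updateFinset

section WithGroup

variable [GaugeGroup G]

/-- the BLOCK FUNCTION of a configuration functional: its fibre section at the trivial exterior `1`. [folklore] -/
def blockFn {β : Type*} (u : GaugeField P j G → β) : (↥Λ → G) → β :=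
  fun y => u (updateFinset 1 Λ y)

omit [MeasurableSpace G] in
/-- under (Det) every fibre section of `u` is the block function. [folklore] -/
theorem section_eq_blockFn_of_dependsOn {β : Type*} {u : GaugeField P j G → β} (h : DependsOn u (Λ : Set (PBond P j)))
    (V : GaugeField P j G) (y : ↥Λ → G) : u (updateFinset V Λ y) = blockFn Λ u y :=
  apply_updateFinset_of_dependsOn Λ h V 1 y

omit [MeasurableSpace G] in
/-- under (Det), `u = blockFn Λ u ∘ Λ.restrict`. [folklore] -/
theorem eq_blockFn_restrict_of_dependsOn {β : Type*} {u : GaugeField P j G → β}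
    (h : DependsOn u (Λ : Set (PBond P j))) (U : GaugeField P j G) : u U = blockFn Λ u (Λ.restrict U) := by
  rw [← section_eq_blockFn_of_dependsOn Λ h U, Function.updateFinset_restrict]

/-- the block function of a measurable functional is measurable. [folklore] -/
theorem measurable_blockFn {β : Type*} [MeasurableSpace β] {u : GaugeField P j G → β} (hu : Measurable u) :
    Measurable (blockFn Λ u) :=
  measurable_section Λ hu 1

section WithHaar

variable [HaarData G]

/-- The BLOCK LAW: the product of the normalised Haar measures over the block variables `Λ → G` — literally the
expression of the tree's `T4TiltModulus.fibreBase Λ` (that U4-side module is not imported into this branch).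
[folklore] -/
noncomputable def blockLaw : Measure (↥Λ → G) := Measure.pi fun _ : ↥Λ => (HaarData.haar : Measure G)

/-- The EXTERIOR LAW: product Haar on the remaining variables `Λᶜ → G`. [folklore] -/
noncomputable def extLaw : Measure ({b // b ∉ Λ} → G) := Measure.pi fun _ : {b // b ∉ Λ} => (HaarData.haar : Measure G)

omit [DecidableEq (PBond P j)] in
/-- `blockLaw Λ` unfolds to the product of Haar measures (`rfl`; = `fibreBase Λ`). [folklore] -/
theorem blockLaw_eq_pi : blockLaw (G := G) Λ = Measure.pi fun _ : ↥Λ => (HaarData.haar : Measure G) := rfl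

omit [DecidableEq (PBond P j)] in
/-- the block law is a probability measure. [folklore] -/
instance blockLaw.isProbabilityMeasure : IsProbabilityMeasure (blockLaw (G := G) Λ) := by
  haveI : IsProbabilityMeasure (HaarData.haar : Measure G) := HaarData.isProb
  unfold blockLaw
  infer_instance

omit [DecidableEq (PBond P j)] in
/-- the exterior law is a probability measure. [folklore] -/
instance extLaw.isProbabilityMeasure : IsProbabilityMeasure (extLaw (G := G) Λ) := by
  haveI : IsProbabilityMeasure (HaarData.haar : Measure G) := HaarData.isProb
  unfold extLaw
  infer_instance

/-- **THE BLOCK SPLIT IS MEASURE-PRESERVING**: product Haar on all bonds is the product of product Haar on the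
block and product Haar on the exterior (Mathlib's `measurePreserving_piEquivPiSubtypeProd`) — the block variables
and the exterior variables are INDEPENDENT under `fieldMeasure`. [folklore] -/
theorem measurePreserving_blockSplit :
    MeasurePreserving (blockSplit (G := G) Λ) (fieldMeasure P j G) ((blockLaw Λ).prod (extLaw Λ)) := by
  haveI : IsProbabilityMeasure (HaarData.haar : Measure G) := HaarData.isProb
  have h := measurePreserving_piEquivPiSubtypeProd (fun _ : PBond P j => (HaarData.haar : Measure G)) (· ∈ Λ)
  refine ⟨(blockSplit (G := G) Λ).measurable, h.map_eq.trans ?_⟩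
  -- the two sides differ only in the `Fintype ↥Λ` instance under `Measure.pi` (a subsingleton)
  unfold blockLaw extLaw
  congr 1
  congr 1
  all_goals exact Subsingleton.elim _ _

/-- independence of block and exterior, as a product formula for cylinder events. [folklore] -/
theorem fieldMeasure_preimage_prod {A : Set (↥Λ → G)} {B : Set ({b // b ∉ Λ} → G)}
    (hA : MeasurableSet A) (hB : MeasurableSet B) :
    fieldMeasure P j G (blockSplit (G := G) Λ ⁻¹' (A ×ˢ B)) = blockLaw Λ A * extLaw Λ B := by
  rw [(measurePreserving_blockSplit Λ).measure_preimage (hA.prod hB).nullMeasurableSet, Measure.prod_prod]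

/-! ## §4  (M1) on the realized law from (M1) on the fibres, the exterior frozen -/

/-- **REALIZED (M1) FROM FIBRE (M1), EXTERIOR FROZEN.**  The realized single-run law of the pending fluctuation
integral is product Haar tilted by a measurable density `F` (the good term's non-negative integrand with the slot's
own indicator removed); the tested variable `u` is a measurable functional of the configuration.  If for EVERY
exterior configuration `V` the block law tilted by the fibre section `y ↦ F (updateFinset V Λ y)` satisfies (M1) for
the fibre section of `u` with the same constant, then the realized law satisfies (M1) for `u` —
`T4ShellMeasureLocal.slotAntiConcentration_of_sections` BY NAME, transported through the measure-preserving block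
split. [folklore] -/
theorem slotAntiConcentration_realized_of_sections {F : GaugeField P j G → ℝ≥0∞} (hF : Measurable F)
    {u : GaugeField P j G → ℝ} (hu : Measurable u) {θ ρ Dc : ℝ}
    (h : ∀ V : GaugeField P j G, SlotAntiConcentration
      ((blockLaw Λ).withDensity fun y => F (updateFinset V Λ y)) (fun y => u (updateFinset V Λ y)) θ ρ Dc) :
    SlotAntiConcentration ((fieldMeasure P j G).withDensity F) u θ ρ Dc := by
  have hF' : Measurable (F ∘ (blockSplit (G := G) Λ).symm) := hF.comp (blockSplit (G := G) Λ).symm.measurable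
  have hu' : Measurable (u ∘ (blockSplit (G := G) Λ).symm) := hu.comp (blockSplit (G := G) Λ).symm.measurable
  have hsec : ∀ z, SlotAntiConcentration
      ((blockLaw Λ).withDensity fun y => (F ∘ (blockSplit (G := G) Λ).symm) (y, z))
      (fun y => (u ∘ (blockSplit (G := G) Λ).symm) (y, z)) θ ρ Dc := by
    intro z
    obtain ⟨V₀, hV₀⟩ : ∃ V₀ : GaugeField P j G, (blockSplit (G := G) Λ V₀).2 = z :=
      ⟨(blockSplit (G := G) Λ).symm (1, z), by rw [MeasurableEquiv.apply_symm_apply]⟩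
    subst hV₀
    simp only [Function.comp_apply, blockSplit_symm_apply_eq_updateFinset]
    exact h V₀
  have ht := slotAntiConcentration_withDensity_comap (measurePreserving_blockSplit (G := G) Λ) hF'
    (slotAntiConcentration_of_sections (blockLaw Λ) (extLaw Λ) hF' hu' hsec)
  have hFe : (F ∘ (blockSplit (G := G) Λ).symm) ∘ (blockSplit (G := G) Λ) = F :=
    funext fun U => congrArg F ((blockSplit (G := G) Λ).symm_apply_apply U)
  have hue : (u ∘ (blockSplit (G := G) Λ).symm) ∘ (blockSplit (G := G) Λ) = u :=
    funext fun U => congrArg u ((blockSplit (G := G) Λ).symm_apply_apply U)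
  rwa [hFe, hue] at ht

/-- **REALIZED (M1) UNDER (Det).**  With (Det) — `DependsOn u ↑Λ` — every fibre section of the tested variable is
the ONE block function `blockFn Λ u`; the fibre hypothesis is then about the law of that one function under the
block law tilted by the section density (which still depends on the exterior: that uniformity is the content of the
binders (DC-loc)/(KEPT-FI), not of (Det)). [folklore] -/
theorem slotAntiConcentration_realized_of_dependsOn {F : GaugeField P j G → ℝ≥0∞} (hF : Measurable F)
    {u : GaugeField P j G → ℝ} (hu : Measurable u) (hdet : DependsOn u (Λ : Set (PBond P j))) {θ ρ Dc : ℝ}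
    (h : ∀ V : GaugeField P j G, SlotAntiConcentration
      ((blockLaw Λ).withDensity fun y => F (updateFinset V Λ y)) (blockFn Λ u) θ ρ Dc) :
    SlotAntiConcentration ((fieldMeasure P j G).withDensity F) u θ ρ Dc :=
  slotAntiConcentration_realized_of_sections Λ hF hu fun V => by
    have hV : (fun y => u (updateFinset V Λ y)) = blockFn Λ u :=
      funext fun y => section_eq_blockFn_of_dependsOn Λ hdet V y
    rw [hV]
    exact h V

/-! ## §5  The local member (γ_loc) over the realized configuration space -/

variable {E : Type*} [NormedAddCommGroup E] [NormedSpace ℝ E] [MeasurableSpace E] [BorelSpace E]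
  [FiniteDimensional ℝ E] [Nontrivial E] (μE : Measure E) [μE.IsAddHaarMeasure]

/-- **THE (γ_loc) ANTI-CONCENTRATION PRODUCER OVER THE REALIZED SPACE.**  Data: the bonds `Λ` of the slot's
localization cube; for every exterior configuration `V` a block chart (CH) — chart space `E` (finite-dimensional,
additive Haar measure `μE`), chart map `κ V`, Jacobian weight `J V`, window `w V` with
`(blockLaw Λ).withDensity (w V) = (μE.withDensity (J V)).map (κ V)` (the chart may depend on the exterior: print's
small-field charts are centred at backgrounds determined by the exterior); the realized density `F`, whose fibre
sections are `window × rest`, `F (updateFinset V Λ y) = w V y · R V y`; the tested variable `u`.  If on every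
contraction ray of every chart the per-fibre alternative of `T4ShellMeasureAnalytic` holds for the log-polar density
of `J V·(R V ∘ κ V)` and the variable read in the chart, then the REALIZED law `(fieldMeasure P j G).withDensity F`
satisfies (M1) for `u` with `D = 2·fibreCoef δ B ℓ₀ L`: `T4ShellMeasurePolar.slotAntiConcentration_withDensity` in
the chart, `slotAntiConcentration_of_chart` onto the block, `slotAntiConcentration_realized_of_sections` onto the
configuration space.  NO multiplicity, NO presentation binder; every located input ((CH), the window factorisation,
the per-fibre alternatives = (AN)+(DC-loc)+(FI)) a hypothesis. [folklore] -/
theorem slotAntiConcentration_realized_local {κ : GaugeField P j G → E → (↥Λ → G)} (hκ : ∀ V, Measurable (κ V))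
    {J : GaugeField P j G → E → ℝ≥0∞} (hJ : ∀ V, Measurable (J V))
    {w R : GaugeField P j G → (↥Λ → G) → ℝ≥0∞} (hw : ∀ V, Measurable (w V)) (hR : ∀ V, Measurable (R V))
    (hchart : ∀ V, (blockLaw Λ).withDensity (w V) = (μE.withDensity (J V)).map (κ V))
    {F : GaugeField P j G → ℝ≥0∞} (hF : Measurable F) (hFw : ∀ V y, F (updateFinset V Λ y) = w V y * R V y)
    {u : GaugeField P j G → ℝ} (hu : Measurable u)
    {δ s B θ ρ ℓ₀ L : ℝ} (hδ0 : 0 ≤ δ) (hδ1 : δ < 1) (hB : 0 ≤ B) (hθ : 0 < θ) (hθs : θ ≤ s) (hρ0 : 0 ≤ ρ)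
    (hρ2 : ρ ≤ 1 / 2) (hℓ₀ : -Real.log (1 - ρ) ≤ ℓ₀) (hlam : 0 < L / (1 + δ) - ℓ₀ / (1 - δ))
    (hfib : ∀ V, ∀ y : E, ‖y‖ = 1 →
      FibreAlternative (polarDensity (Module.finrank ℝ E) fun x => J V x * R V (κ V x))
        (((fun y => u (updateFinset V Λ y)) ∘ κ V) ∘ dilate) δ s B θ ρ L y) :
    SlotAntiConcentration ((fieldMeasure P j G).withDensity F) u θ ρ (2 * fibreCoef δ B ℓ₀ L) :=
  slotAntiConcentration_realized_of_sections Λ hF hu fun V => by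
    have hsecF : (fun y => F (updateFinset V Λ y)) = fun y => w V y * R V y := funext (hFw V)
    rw [hsecF]
    exact slotAntiConcentration_of_chart (blockLaw Λ) μE (hκ V) (hJ V) (hw V) (hchart V) (hR V)
      (measurable_section Λ hu V)
      (slotAntiConcentration_withDensity μE
        (show Measurable (fun x => J V x * R V (κ V x)) from (hJ V).mul ((hR V).comp (hκ V)))
        ((measurable_section Λ hu V).comp (hκ V)) hδ0 hδ1 hB hθ hθs hρ0 hρ2 hℓ₀ hlam (hfib V))

/-- **THE SAME UNDER (Det)**: the variable read in every chart is the ONE block function, `blockFn Λ u ∘ κ V`.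
[folklore] -/
theorem slotAntiConcentration_realized_local_of_dependsOn {κ : GaugeField P j G → E → (↥Λ → G)}
    (hκ : ∀ V, Measurable (κ V)) {J : GaugeField P j G → E → ℝ≥0∞} (hJ : ∀ V, Measurable (J V))
    {w R : GaugeField P j G → (↥Λ → G) → ℝ≥0∞} (hw : ∀ V, Measurable (w V)) (hR : ∀ V, Measurable (R V))
    (hchart : ∀ V, (blockLaw Λ).withDensity (w V) = (μE.withDensity (J V)).map (κ V))
    {F : GaugeField P j G → ℝ≥0∞} (hF : Measurable F) (hFw : ∀ V y, F (updateFinset V Λ y) = w V y * R V y)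
    {u : GaugeField P j G → ℝ} (hu : Measurable u) (hdet : DependsOn u (Λ : Set (PBond P j)))
    {δ s B θ ρ ℓ₀ L : ℝ} (hδ0 : 0 ≤ δ) (hδ1 : δ < 1) (hB : 0 ≤ B) (hθ : 0 < θ) (hθs : θ ≤ s) (hρ0 : 0 ≤ ρ)
    (hρ2 : ρ ≤ 1 / 2) (hℓ₀ : -Real.log (1 - ρ) ≤ ℓ₀) (hlam : 0 < L / (1 + δ) - ℓ₀ / (1 - δ))
    (hfib : ∀ V, ∀ y : E, ‖y‖ = 1 →
      FibreAlternative (polarDensity (Module.finrank ℝ E) fun x => J V x * R V (κ V x))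
        ((blockFn Λ u ∘ κ V) ∘ dilate) δ s B θ ρ L y) :
    SlotAntiConcentration ((fieldMeasure P j G).withDensity F) u θ ρ (2 * fibreCoef δ B ℓ₀ L) := by
  refine slotAntiConcentration_realized_local Λ μE hκ hJ hw hR hchart hF hFw hu hδ0 hδ1 hB hθ hθs hρ0 hρ2 hℓ₀
    hlam fun V y hy => ?_
  have hV : (fun y => u (updateFinset V Λ y)) = blockFn Λ u :=
    funext fun y => section_eq_blockFn_of_dependsOn Λ hdet V y
  rw [hV]
  exact hfib V y hy

/-- **THE LOCAL MEMBER (γ_loc) END TO END OVER THE REALIZED CONFIGURATION SPACE, MASS RATIO PLACED (`M = 2`).**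
The realized-space twin of `T4ShellMeasureLocal.slot_field_of_localDilation_placed`: the dominating law is the
REALIZED one, `μ′ = (fieldMeasure P j G).withDensity (F·χ)` (`F` = the windowed small-field weight part, fibre
sections `w V·R V`; `χ` = the KEPT co-tests, non-decreasing along every contraction ray of every chart); the shell
pieces, the dropped co-tests' failure events and the all-pass domination are stated for `μ′` ITSELF (no chart in
them); the per-fibre alternative is stated in the charts.  Conclusion: the `LevelLedger.slot`-shaped field
`Σ_τ piece τ ≤ ((8e²/(1−δ))·B·ρ)·Σ_τ A τ` at the admissible window `B·ℓ₀ ≤ (1−δ)/2` (`window_admissible`,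
`fibreCoef_window_le`, `slot_field_of_massRatio`, `mass_le_two_mul_of_unionBound` BY NAME). [folklore] -/
theorem slot_field_realized_placed {ι : Type*} {κ : GaugeField P j G → E → (↥Λ → G)} (hκ : ∀ V, Measurable (κ V))
    {J : GaugeField P j G → E → ℝ≥0∞} (hJ : ∀ V, Measurable (J V))
    {w R : GaugeField P j G → (↥Λ → G) → ℝ≥0∞} (hw : ∀ V, Measurable (w V)) (hR : ∀ V, Measurable (R V))
    (hchart : ∀ V, (blockLaw Λ).withDensity (w V) = (μE.withDensity (J V)).map (κ V))
    {F χ : GaugeField P j G → ℝ≥0∞} (hF : Measurable F) (hχ : Measurable χ)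
    (hFw : ∀ V y, F (updateFinset V Λ y) = w V y * R V y)
    [IsFiniteMeasure ((fieldMeasure P j G).withDensity fun U => F U * χ U)]
    {u : GaugeField P j G → ℝ} (hu : Measurable u)
    {δ s B θ ρ ℓ₀ : ℝ} (hδ0 : 0 ≤ δ) (hδ1 : δ < 1) (hB : 0 < B) (hθ : 0 < θ) (hθs : θ ≤ s)
    (hρ0 : 0 ≤ ρ) (hρ2 : ρ ≤ 1 / 2) (hℓ₀ : -Real.log (1 - ρ) ≤ ℓ₀) (hBℓ : B * ℓ₀ ≤ (1 - δ) / 2)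
    (hfib : ∀ V, ∀ y : E, ‖y‖ = 1 →
      FibreAlternative (polarDensity (Module.finrank ℝ E) fun x => J V x * R V (κ V x))
        (((fun y => u (updateFinset V Λ y)) ∘ κ V) ∘ dilate) δ s B θ ρ ((1 + δ) * (ℓ₀ / (1 - δ) + 1 / B)) y)
    (hmono : ∀ V, ∀ y : E, ‖y‖ = 1 → Monotone fun r : ℝ => χ (updateFinset V Λ (κ V (Real.exp (-r) • y))))
    (T : Finset ι) {piece A : ι → ℝ} {Mw : ℝ} (hMw : 0 ≤ Mw)
    (hpiece : ∑ τ ∈ T, piece τ ≤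
      Mw * (((fieldMeasure P j G).withDensity fun U => F U * χ U) {U | θ * (1 - ρ) ≤ u U ∧ u U < θ}).toReal)
    {κ' : Type*} (I : Finset κ') (Fail : κ' → Set (GaugeField P j G)) {q : ℝ}
    (hfail : ∀ i ∈ I, ((fieldMeasure P j G).withDensity fun U => F U * χ U) (Fail i) ≤
      ENNReal.ofReal q * ((fieldMeasure P j G).withDensity fun U => F U * χ U) univ)
    (hm : (I.card : ℝ) * q ≤ 1 / 2)
    (hpass : Mw * (((fieldMeasure P j G).withDensity fun U => F U * χ U) (⋂ i ∈ I, (Fail i)ᶜ)).toReal ≤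
      ∑ τ ∈ T, A τ) :
    ∑ τ ∈ T, piece τ ≤ (8 * Real.exp 2 / (1 - δ) * B * ρ) * ∑ τ ∈ T, A τ := by
  have hδ1' : -1 < δ := by linarith
  have hlam : 0 < (1 + δ) * (ℓ₀ / (1 - δ) + 1 / B) / (1 + δ) - ℓ₀ / (1 - δ) := window_admissible hδ1' hB
  -- (M1) for the realized dominating law, with the kept co-tests inside the density
  have hac : SlotAntiConcentration ((fieldMeasure P j G).withDensity fun U => F U * χ U) u θ ρ
      (2 * fibreCoef δ B ℓ₀ ((1 + δ) * (ℓ₀ / (1 - δ) + 1 / B))) := by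
    refine slotAntiConcentration_realized_local Λ μE hκ hJ hw (R := fun V y => R V y * χ (updateFinset V Λ y))
      (fun V => (hR V).mul (measurable_section Λ hχ V)) hchart (F := fun U => F U * χ U) (hF.mul hχ)
      (fun V y => show F _ * χ _ = _ by rw [hFw V y, mul_assoc]) hu hδ0 hδ1 hB.le hθ hθs hρ0 hρ2 hℓ₀ hlam
      fun V y hy => ?_
    exact fibreAlternative_congr (fun r => by simp only [polarDensity_of_norm_eq_one hy, mul_assoc])
      (fibreAlternative_polarDensity_mul (χ := fun x => χ (updateFinset V Λ (κ V x))) hy (hfib V y hy)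
        (hmono V y hy))
  have hle : 2 * fibreCoef δ B ℓ₀ ((1 + δ) * (ℓ₀ / (1 - δ) + 1 / B)) ≤ 4 * Real.exp 2 / (1 - δ) * B := by
    have h := fibreCoef_window_le hδ1 hδ1' hB hBℓ
    calc 2 * fibreCoef δ B ℓ₀ ((1 + δ) * (ℓ₀ / (1 - δ) + 1 / B)) ≤ 2 * (2 * Real.exp 2 * B / (1 - δ)) := by
          linarith
      _ = 4 * Real.exp 2 / (1 - δ) * B := by ring
  have h1δ : 0 < 1 - δ := by linarith
  have h := slot_field_of_massRatio (by positivity) hρ0 (slotAntiConcentration_mono hρ0 hle hac) T hMw hpiece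
    (M := 2) (mass_le_two_mul_of_unionBound _ I Fail hfail hm hMw hpass)
  calc ∑ τ ∈ T, piece τ ≤ (4 * Real.exp 2 / (1 - δ) * B * 2 * ρ) * ∑ τ ∈ T, A τ := h
    _ = (8 * Real.exp 2 / (1 - δ) * B * ρ) * ∑ τ ∈ T, A τ := by ring

end WithHaar

end WithGroup

end Realized

/-! ## §6  Non-vacuity toys -/

section NonVacuity

/-- (CH) is satisfiable: the one-point block (`Unit`, Dirac law, window `1`) is charted by the real line with
Jacobian weight the indicator of `[0, 1]` and the constant chart map — Lebesgue mass `1` pushed to the point. [folklore] -/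
example : (Measure.dirac ()).withDensity 1 =
    ((volume : Measure ℝ).withDensity ((Icc (0 : ℝ) 1).indicator 1)).map (fun _ => ()) := by
  rw [withDensity_one, Measure.map_const, withDensity_apply _ MeasurableSet.univ, Measure.restrict_univ,
    lintegral_indicator measurableSet_Icc]
  simp

variable {P : Params} {j : ℕ} {G : Type*} [GaugeGroup G] [MeasurableSpace G] [HaarData G] [DecidableEq (PBond P j)]

/-- (Det) is satisfiable and says what it should: a functional reading ONE bond depends only on that bond … -/
example (b₀ : PBond P j) (g : G → ℝ) :
    DependsOn (fun U : GaugeField P j G => g (U b₀)) (({b₀} : Finset (PBond P j)) : Set (PBond P j)) :=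
  fun _ _ h => by simp only [h b₀ (by simp)]

/-- … its fibre sections along `{b₀}` ignore the exterior, and its block function is `g` read on the block variable.
[folklore] -/
example (b₀ : PBond P j) (g : G → ℝ) (V : GaugeField P j G) (y : ↥({b₀} : Finset (PBond P j)) → G) :
    (fun U : GaugeField P j G => g (U b₀)) (updateFinset V {b₀} y) = g (y ⟨b₀, Finset.mem_singleton_self b₀⟩) ∧
    blockFn {b₀} (fun U : GaugeField P j G => g (U b₀)) y = g (y ⟨b₀, Finset.mem_singleton_self b₀⟩) := by
  constructor <;> simp [blockFn, updateFinset]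

/-- the block split glues as `updateFinset` (a `decide`-free instance of `blockSplit_symm_apply_eq_updateFinset`). -/
example (Λ : Finset (PBond P j)) (y : ↥Λ → G) (V : GaugeField P j G) :
    (blockSplit (G := G) Λ).symm (y, (blockSplit (G := G) Λ V).2) = updateFinset V Λ y :=
  blockSplit_symm_apply_eq_updateFinset Λ y V

end NonVacuity

end Literature.MathematicalPhysics.QuantumFieldTheory.Balaban1983to89.T4ShellMeasureDet
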